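import Mathlib
import HarnessLib
import Literature.Analysis.FluidPDE.VorticityEquation
import Literature.Analysis.FluidPDE.AncientSimilarityVorticity
import Literature.Analysis.FluidPDE.VectorCalculusProofs
import Summits.NavierStokesRegularity.NavierStokesRegularity.Theorems.UnthreadedRigidityDoorWindowAnalytic

/-!
# Route `UnthreadedRigidityDoor`, wall item W2 `UnthreadedRigidity` (stmt-NavierStokesRegularity-27585) — LINE g12-2 «PERSISTENCE FILTER»
# (ns-idea-6 g12, `Persistence_sketch.lean` 09bc8f71301208c4; idea-crit-7 g8 PASS 08:21Z; DIRECTOR-NS #294): piece M1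
# «the classical VORTICITY IDENTITY in the interior of a bounded mild window»

Seat ns-es-p1 g8 (W2 second queue; announce-before-propose on the ideators bus).  The window hypotheses of the crux `UnthreadedRigidity` WITHOUT
unthreadedness and WITHOUT preconnectedness: an open time set `S`, a field `u` jointly continuous on `S × ℝ³`, divergence-free slices, the Oseen
integral identity `u(t) = e^{(t−s)Δ}u(s) − B¹ₛ(u,u)(t)` between times `s < t` of `S`, a sup bound on every initial segment `S ∩ (−∞, τ]`.

* `curl_cross_curl_eq` — the LAMB/STRETCHING dictionary for a `C²` divergence-free slice: `curl(ω × v) = (v·∇)ω − (ω·∇)v`, `ω = curl v`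
  (tree `curl_cross_apply` with `div v = 0`, `div ω = 0`).
* `window_vorticity_stretching` — at every `t ∈ S`, `x`: `∂ₜω + (u·∇)ω = (ω·∇)u + Δω` with the TWO-SIDED time derivative
  `deriv (fun s => curl (u s) x) t` (the tree's `…UnthreadedRigidity.exists_isClassicalNSSolutionOn_Ioo` — window ⇒ classical Navier–Stokes on a strip
  around `t`, Fabes–Jones–Rivière — then `IsClassicalNSSolutionOn.isVorticitySolutionOn_of_isOpen` and `derivWithin_of_isOpen`).
* `window_lambCurl_eq` — **M1**: `∂ₜω + curl(ω × u) = Δω`, i.e.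
  `deriv (fun s => curl (u s) x) t + curl (fun y => cross (curl (u t) y) (u t y)) x = Δ (curl (u t)) x` — the middle term is literally the sketch's
  `lambCurl (u t) x`.  This is the input of the sketch's bridge M `WindowVorticityBalance` (M2 = the single-shell bookkeeping on top of it).
* `window_contDiff_slice`, `window_differentiable_time_curl` — regularity by-products for M2 (smooth slices; `s ↦ curl (u s) x` differentiable at `t`).

HONEST LABEL: interior-regularity bookkeeping for HYPOTHETICAL bounded window solutions, reusing the tree (KNSS smoothing, FJR, Majda–Bertozzi Prop. 2.21);
nothing here bears on `UnthreadedRigidity` (27585), the door Target, W2 or Navier–Stokes regularity; no summit statement is proved.  MODEL/rung work.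
-/

noncomputable section

-- the summit and its single sub-problem share the name (CONVENTIONS §1), as in every Theorems file
set_option linter.dupNamespace false

namespace Summit.NavierStokesRegularity.NavierStokesRegularity.Theorems.UnthreadedRigidity.Persistence

open Set Function Filter Topology
open scoped RealInnerProductSpace Laplacian ContDiff
open Literature.Analysis Literature.Analysis.FluidPDE
open Literature.Analysis.UnboundedOperators (heatExtension)
open Summit.NavierStokesRegularity.NavierStokesRegularity.Theorems.UnthreadedRigidity

/-! ## The Lamb/stretching dictionary for one slice -/

/-- **`curl(ω × v) = (v·∇)ω − (ω·∇)v`** for a `C²` divergence-free field `v` on `ℝ³`, `ω = curl v` (`div ω = 0` automatically). -/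
theorem curl_cross_curl_eq {v : EuclideanSpace ℝ (Fin 3) → EuclideanSpace ℝ (Fin 3)} (hv : ContDiff ℝ 2 v)
    (hdiv : VectorCalculus.IsDivFree v) (x : EuclideanSpace ℝ (Fin 3)) :
    curl (fun y => cross (curl v y) (v y)) x = convect v (curl v) x - convect (curl v) v x := by
  have hω1 : ContDiff ℝ 1 (curl v) := contDiff_curl (n := 1) (by exact_mod_cast hv)
  have dω : DifferentiableAt ℝ (curl v) x := (hω1.differentiable one_ne_zero) x
  have dv : DifferentiableAt ℝ v x := (hv.differentiable (by simp)) x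
  have hdivω : VectorCalculus.divergence (curl v) x = 0 := divergence_curl_eq_zero_holds v hv x
  rw [curl_cross_apply dω dv, hdivω, hdiv x, zero_smul, zero_smul, convect_apply, convect_apply]
  abel

/-! ## The window: smooth slices and the classical strip -/

section Window

variable {S : Set ℝ} {u : ℝ → EuclideanSpace ℝ (Fin 3) → EuclideanSpace ℝ (Fin 3)}

/-- Every slice of a bounded mild window is `C^∞` (KNSS smoothing, tree `isSmoothSpaceTimeOn_of_oseenMild_of_isOpen`). -/
theorem window_contDiff_slice (hS : IsOpen S) (hcont : ContinuousOn (uncurry u) (S ×ˢ univ))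
    (hmild : ∀ s ∈ S, ∀ t ∈ S, s < t → ∀ x, u t x = heatExtension (u s) (t - s) x - oseenDuhamel 1 s u u t x)
    (hbdd : ∀ τ ∈ S, ∃ B : ℝ, ∀ t ∈ S, t ≤ τ → ∀ x, ‖u t x‖ ≤ B) {t : ℝ} (ht : t ∈ S) : ContDiff ℝ ∞ (u t) :=
  (isSmoothSpaceTimeOn_of_oseenMild_of_isOpen hS hcont hmild hbdd).contDiff_slice ht

/-- **The stretching form with a two-sided time derivative**: at every `t ∈ S` and `x`,
`∂ₜ(curl u)(t,x) + (u·∇)ω = (ω·∇)u + Δω`, `ω = curl (u t)`, where `∂ₜ` is `deriv` of `s ↦ curl (u s) x` (the window is open).  Also records that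
`s ↦ curl (u s) x` is differentiable at `t`. -/
theorem window_vorticity_stretching (hS : IsOpen S) (hcont : ContinuousOn (uncurry u) (S ×ˢ univ))
    (hdiv : ∀ t ∈ S, VectorCalculus.IsDivFree (u t))
    (hmild : ∀ s ∈ S, ∀ t ∈ S, s < t → ∀ x, u t x = heatExtension (u s) (t - s) x - oseenDuhamel 1 s u u t x)
    (hbdd : ∀ τ ∈ S, ∃ B : ℝ, ∀ t ∈ S, t ≤ τ → ∀ x, ‖u t x‖ ≤ B) {t : ℝ} (ht : t ∈ S) (x : EuclideanSpace ℝ (Fin 3)) :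
    DifferentiableAt ℝ (fun s => curl (u s) x) t ∧
      deriv (fun s => curl (u s) x) t + convect (u t) (curl (u t)) x = convect (curl (u t)) (u t) x + (Δ (curl (u t))) x := by
  obtain ⟨s, T₂, hst, htT, hsub, p, hcl⟩ := exists_isClassicalNSSolutionOn_Ioo hS hcont hdiv hmild hbdd ht
  have hV : IsVorticitySolutionOn (Ioo s T₂) 1 u := hcl.isVorticitySolutionOn_of_isOpen isOpen_Ioo fun _ _ y => curl_zero y
  have ht' : t ∈ Ioo s T₂ := ⟨hst, htT⟩
  have key := hV.vorticity_eq t ht' x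
  rw [timeDerivWithin_apply, derivWithin_of_isOpen isOpen_Ioo ht', one_smul] at key
  -- differentiability in time at the interior point `t` (joint smoothness on the open strip)
  have hsm : IsSmoothSpaceTimeOn (Ioo s T₂) u := hcl.smooth_velocity
  have hωsm : IsSmoothSpaceTimeOn (Ioo s T₂) (vorticity u) := hsm.isSmoothSpaceTimeOn_vorticity isOpen_Ioo.uniqueDiffOn
  have hdw : DifferentiableWithinAt ℝ (fun r => vorticity u r x) (Ioo s T₂) t := hωsm.differentiableWithinAt_time ht' x
  have hda : DifferentiableAt ℝ (fun r => curl (u r) x) t := by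
    have h := hdw.differentiableAt (isOpen_Ioo.mem_nhds ht')
    simpa only [vorticity_apply] using h
  refine ⟨hda, ?_⟩
  simpa only [vorticity_apply] using key

/-- `s ↦ curl (u s) x` is differentiable at every `t ∈ S` (by-product for the single-shell bookkeeping). -/
theorem window_differentiable_time_curl (hS : IsOpen S) (hcont : ContinuousOn (uncurry u) (S ×ˢ univ))
    (hdiv : ∀ t ∈ S, VectorCalculus.IsDivFree (u t))
    (hmild : ∀ s ∈ S, ∀ t ∈ S, s < t → ∀ x, u t x = heatExtension (u s) (t - s) x - oseenDuhamel 1 s u u t x)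
    (hbdd : ∀ τ ∈ S, ∃ B : ℝ, ∀ t ∈ S, t ≤ τ → ∀ x, ‖u t x‖ ≤ B) {t : ℝ} (ht : t ∈ S) (x : EuclideanSpace ℝ (Fin 3)) :
    DifferentiableAt ℝ (fun s => curl (u s) x) t :=
  (window_vorticity_stretching hS hcont hdiv hmild hbdd ht x).1

/-- **M1 — the classical VORTICITY IDENTITY in the interior of a bounded mild window (Lamb form):**
`∂ₜω + curl(ω × u) = Δω` at every `t ∈ S` and every `x`, with `ω = curl (u t)` and the two-sided time derivative. -/
theorem window_lambCurl_eq (hS : IsOpen S) (hcont : ContinuousOn (uncurry u) (S ×ˢ univ))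
    (hdiv : ∀ t ∈ S, VectorCalculus.IsDivFree (u t))
    (hmild : ∀ s ∈ S, ∀ t ∈ S, s < t → ∀ x, u t x = heatExtension (u s) (t - s) x - oseenDuhamel 1 s u u t x)
    (hbdd : ∀ τ ∈ S, ∃ B : ℝ, ∀ t ∈ S, t ≤ τ → ∀ x, ‖u t x‖ ≤ B) {t : ℝ} (ht : t ∈ S) (x : EuclideanSpace ℝ (Fin 3)) :
    deriv (fun s => curl (u s) x) t + curl (fun y => cross (curl (u t) y) (u t y)) x = (Δ (curl (u t))) x := by
  have h := (window_vorticity_stretching hS hcont hdiv hmild hbdd ht x).2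
  have hu2 : ContDiff ℝ 2 (u t) := (window_contDiff_slice hS hcont hmild hbdd ht).of_le (by norm_cast)
  rw [curl_cross_curl_eq hu2 (hdiv t ht) x]
  linear_combination (norm := skip) h
  abel

end Window

end Summit.NavierStokesRegularity.NavierStokesRegularity.Theorems.UnthreadedRigidity.Persistence

end
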